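import Summits.Ventures.PercRepro.S1TriangleCountBootEight

/-!
# PercRepro — THE TRIANGLE KERNEL AT NULLITY `6`, THE LEMMAS (p8, gen 24; a feeder for S4 — the rows `≤ 36` of the
`q = 7` window)

The refined bootstrap gives `s₃ ≤ triBound8 6 = 11` at nullity `6`; the value `11` is never attained (the truth is `10`,
`M(K₅)`). At the point `x` on the fewest triangles (`m := t_x`), `s₃ = 11` forces `m = 3` (`s₃ ≤ m + 8`, `m + 2m² ≤ 33`),
`|U| ∈ {10, 11}` for `U = ⋃ triangles` (the double count and the restriction step with (C2), (C3)), with `r(U) = 5` when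
`|U| = 11`. Write `C₁, C₂, C₃` for the triangles through `x`, `St` for their union (`7` points, rank `4`), `P_ij =
cl(Cᵢ ∪ Cⱼ)` for the three planes and `Q = U ∖ St`. The lemmas of this module:
* `three_le_eRk_union_singleton_of_mem_triangles` — a triangle and a point off it span rank `≥ 3` ((C1));
* `false_of_mem_closure_union_of_mem_closure_union` — no point off `Cᵢ` lies in two planes `P_ij`, `P_ik`
  (submodularity: the planes would span a rank-`3` set containing the `7` points of `St`, against (C2));
* `false_of_inter_nonempty_of_inter_nonempty_of_inter_nonempty` — NO TRANSVERSAL: a triangle avoiding `x` cannot meet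
  all three `Cᵢ` (it lies in `P_ij` and drags `C_k` into it);
* `exists_mem_notMem_star_of_notMem` — a triangle avoiding `x` has a point off `St` (each `Cᵢ` carries at most one of
  its points);
* `exists_pair_closure_of_forall_mem_star` — a triangle through `q` whose other two points are in `St` puts `q` into a
  plane `P_ij` and meets `Cᵢ`, `Cⱼ`;
* `exists_mem_notMem_closure_of_notMem_closure` — a triangle through a point `q ∉ cl(St)` has a second point off `cl(St)`.
The kernel itself is `S1TriangleKernelSix.ncard_triangles_le_ten_of_nullity_six`. Axioms: standard.
-/

open scoped Matroid

namespace PercRepro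

namespace S1

open Set

variable {α : Type}

/-- **A triangle and a point off it span rank `≥ 3`** ((C1): a rank-`2` set has at most `3` points). -/
theorem three_le_eRk_union_singleton_of_mem_triangles (M : Matroid α) [M.Finite]
    (hC1 : ∀ L ⊆ M.E, M.eRk L = 2 → L.ncard ≤ 3) {C : Set α} (hC : C ∈ ThmN.triangles M)
    {q : α} (hqE : q ∈ M.E) (hqC : q ∉ C) : (3 : ℕ∞) ≤ M.eRk (C ∪ {q}) := by
  have hCE : C ⊆ M.E := hC.1.subset_ground
  have hCfin : C.Finite := M.ground_finite.subset hCE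
  obtain ⟨a, ha⟩ := hC.1.nonempty
  have hr2 : M.eRk C = 2 := ThmN.eRk_eq_two_of_mem_trianglesThrough M ⟨hC.1, hC.2, ha⟩
  by_contra hlt
  push Not at hlt
  have hge : (2 : ℕ∞) ≤ M.eRk (C ∪ {q}) := by
    rw [← hr2]
    exact M.eRk_mono Set.subset_union_left
  have h3 : (3 : ℕ∞) = 2 + 1 := by norm_num
  rw [h3] at hlt
  have hle : M.eRk (C ∪ {q}) ≤ 2 := Order.le_of_lt_add_one hlt
  have heq : M.eRk (C ∪ {q}) = 2 := le_antisymm hle hge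
  have hsub : C ∪ {q} ⊆ M.E := Set.union_subset hCE (Set.singleton_subset_iff.2 hqE)
  have h := hC1 _ hsub heq
  have hdisj : Disjoint C ({q} : Set α) := Set.disjoint_singleton_right.2 hqC
  rw [Set.ncard_union_eq hdisj hCfin (Set.finite_singleton q), hC.2, Set.ncard_singleton] at h
  omega

/-- **No point off `Cᵢ` lies in two planes `P_ij`, `P_ik`**: the two planes would span a rank-`≤ 3` set (submodularity at
`Cᵢ ∪ {q}`, rank `≥ 3`) containing the `7` points of the star, against (C2). -/
theorem false_of_mem_closure_union_of_mem_closure_union (M : Matroid α) [M.Finite]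
    (hC1 : ∀ L ⊆ M.E, M.eRk L = 2 → L.ncard ≤ 3)
    (hC2 : ∀ X ⊆ M.E, M.eRk X ≤ 3 → X.ncard ≤ 6) {x : α} (hx : M.IsNonloop x)
    {Ci Cj Ck : Set α} (hCi : Ci ∈ ThmN.trianglesThrough M x) (hCj : Cj ∈ ThmN.trianglesThrough M x)
    (hCk : Ck ∈ ThmN.trianglesThrough M x) (hij : Ci ≠ Cj) (hik : Ci ≠ Ck) (hjk : Cj ≠ Ck)
    {q : α} (hqE : q ∈ M.E) (hqCi : q ∉ Ci)
    (hq1 : q ∈ M.closure (Ci ∪ Cj)) (hq2 : q ∈ M.closure (Ci ∪ Ck)) : False := by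
  classical
  have hCiE : Ci ⊆ M.E := hCi.1.subset_ground
  have hCjE : Cj ⊆ M.E := hCj.1.subset_ground
  have hCkE : Ck ⊆ M.E := hCk.1.subset_ground
  set A := Ci ∪ Cj ∪ {q} with hA
  set B := Ci ∪ Ck ∪ {q} with hB
  have hAcl : A ⊆ M.closure (Ci ∪ Cj) := by
    refine Set.union_subset (M.subset_closure (Ci ∪ Cj) (Set.union_subset hCiE hCjE)) ?_
    exact Set.singleton_subset_iff.2 hq1
  have hBcl : B ⊆ M.closure (Ci ∪ Ck) := by
    refine Set.union_subset (M.subset_closure (Ci ∪ Ck) (Set.union_subset hCiE hCkE)) ?_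
    exact Set.singleton_subset_iff.2 hq2
  have hrA : M.eRk A ≤ 3 := by
    calc M.eRk A ≤ M.eRk (M.closure (Ci ∪ Cj)) := M.eRk_mono hAcl
      _ = M.eRk (Ci ∪ Cj) := M.eRk_closure_eq _
      _ ≤ 3 := eRk_union_le_three_of_trianglesThrough M hx hCi hCj
  have hrB : M.eRk B ≤ 3 := by
    calc M.eRk B ≤ M.eRk (M.closure (Ci ∪ Ck)) := M.eRk_mono hBcl
      _ = M.eRk (Ci ∪ Ck) := M.eRk_closure_eq _
      _ ≤ 3 := eRk_union_le_three_of_trianglesThrough M hx hCi hCk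
  have hrAB : (3 : ℕ∞) ≤ M.eRk (A ∩ B) := by
    have hsub : Ci ∪ {q} ⊆ A ∩ B := by
      intro z hz
      rcases hz with hz | hz
      · exact ⟨Or.inl (Or.inl hz), Or.inl (Or.inl hz)⟩
      · exact ⟨Or.inr hz, Or.inr hz⟩
    exact (three_le_eRk_union_singleton_of_mem_triangles M hC1 ⟨hCi.1, hCi.2.1⟩ hqE hqCi).trans
      (M.eRk_mono hsub)
  have hsubmod := M.eRk_inter_add_eRk_union_le A B
  -- pass to `ℕ`
  have hfinU : M.eRk (A ∪ B) ≠ ⊤ := by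
    have hABE : A ∪ B ⊆ M.E := by
      refine Set.union_subset (Set.union_subset (Set.union_subset hCiE hCjE) (Set.singleton_subset_iff.2 hqE)) ?_
      exact Set.union_subset (Set.union_subset hCiE hCkE) (Set.singleton_subset_iff.2 hqE)
    exact ((M.eRk_le_encard _).trans_lt (M.ground_finite.subset hABE).encard_lt_top).ne
  have hfinI : M.eRk (A ∩ B) ≠ ⊤ := by
    have hIE : A ∩ B ⊆ M.E :=
      Set.inter_subset_left.trans (Set.union_subset (Set.union_subset hCiE hCjE) (Set.singleton_subset_iff.2 hqE))
    exact ((M.eRk_le_encard _).trans_lt (M.ground_finite.subset hIE).encard_lt_top).ne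
  obtain ⟨u, hu⟩ := ENat.ne_top_iff_exists.1 hfinU
  obtain ⟨i, hi⟩ := ENat.ne_top_iff_exists.1 hfinI
  have hfinA : M.eRk A ≠ ⊤ := by
    intro h
    rw [h] at hrA
    exact absurd hrA (by simp)
  have hfinB : M.eRk B ≠ ⊤ := by
    intro h
    rw [h] at hrB
    exact absurd hrB (by simp)
  obtain ⟨a, ha⟩ := ENat.ne_top_iff_exists.1 hfinA
  obtain ⟨b, hb⟩ := ENat.ne_top_iff_exists.1 hfinB
  rw [← hu, ← hi, ← ha, ← hb] at hsubmod
  rw [← hi] at hrAB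
  rw [← ha] at hrA
  rw [← hb] at hrB
  have e1 : i + u ≤ a + b := by exact_mod_cast hsubmod
  have e2 : 3 ≤ i := by exact_mod_cast hrAB
  have e3 : a ≤ 3 := by exact_mod_cast hrA
  have e4 : b ≤ 3 := by exact_mod_cast hrB
  have hu3 : u ≤ 3 := by omega
  -- the star lies in `A ∪ B`
  set s : Finset (Set α) := {Ci, Cj, Ck} with hsdef
  have hs : ∀ C ∈ s, C ∈ ThmN.trianglesThrough M x := by
    intro C hC
    simp only [hsdef, Finset.mem_insert, Finset.mem_singleton] at hC
    rcases hC with rfl | rfl | rfl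
    · exact hCi
    · exact hCj
    · exact hCk
  have hscard : s.card = 3 := Finset.card_eq_three.2 ⟨Ci, Cj, Ck, hij, hik, hjk, rfl⟩
  obtain ⟨-, hstar_card⟩ := ThmN.eRk_le_and_ncard_eq_of_triangles M hC1 hx s hs
  rw [hscard] at hstar_card
  have hStsub : ({x} ∪ ⋃ C ∈ s, C) ⊆ A ∪ B := by
    intro z hz
    rcases hz with hz | hz
    · rw [Set.mem_singleton_iff.1 hz]
      exact Or.inl (Or.inl (Or.inl hCi.2.2))
    · obtain ⟨C, hC, hzC⟩ := Set.mem_iUnion₂.1 hz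
      simp only [hsdef, Finset.mem_insert, Finset.mem_singleton] at hC
      rcases hC with rfl | rfl | rfl
      · exact Or.inl (Or.inl (Or.inl hzC))
      · exact Or.inl (Or.inl (Or.inr hzC))
      · exact Or.inr (Or.inl (Or.inr hzC))
  have hStE : ({x} ∪ ⋃ C ∈ s, C) ⊆ M.E := by
    intro z hz
    rcases hz with hz | hz
    · rw [Set.mem_singleton_iff.1 hz]; exact hx.mem_ground
    · obtain ⟨C, hC, hzC⟩ := Set.mem_iUnion₂.1 hz
      exact (hs C hC).1.subset_ground hzC
  have hrSt : M.eRk ({x} ∪ ⋃ C ∈ s, C) ≤ 3 := by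
    calc M.eRk ({x} ∪ ⋃ C ∈ s, C) ≤ M.eRk (A ∪ B) := M.eRk_mono hStsub
      _ = (u : ℕ∞) := hu.symm
      _ ≤ 3 := by exact_mod_cast hu3
  have := hC2 _ hStE hrSt
  omega

/-- **No transversal**: a triangle `T` avoiding `x` cannot meet all three triangles `Cᵢ, Cⱼ, C_k` through `x` — it
would lie in `cl(Cᵢ ∪ Cⱼ)` (two of its points) and carry its point of `C_k` there, hence all of `C_k`: two points off
`Cᵢ ∪ Cⱼ` in `cl(Cᵢ ∪ Cⱼ)`, against (C2). -/
theorem false_of_inter_nonempty_of_inter_nonempty_of_inter_nonempty (M : Matroid α) [M.Finite]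
    (hC1 : ∀ L ⊆ M.E, M.eRk L = 2 → L.ncard ≤ 3)
    (hC2 : ∀ X ⊆ M.E, M.eRk X ≤ 3 → X.ncard ≤ 6) {x : α} (hx : M.IsNonloop x)
    {Ci Cj Ck : Set α} (hCi : Ci ∈ ThmN.trianglesThrough M x) (hCj : Cj ∈ ThmN.trianglesThrough M x)
    (hCk : Ck ∈ ThmN.trianglesThrough M x) (hij : Ci ≠ Cj) (hik : Ci ≠ Ck) (hjk : Cj ≠ Ck)
    {T : Set α} (hT : T ∈ ThmN.triangles M) (hxT : x ∉ T)
    (hTi : (T ∩ Ci).Nonempty) (hTj : (T ∩ Cj).Nonempty) (hTk : (T ∩ Ck).Nonempty) : False := by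
  obtain ⟨a, haT, haCi⟩ := hTi
  obtain ⟨b, hbT, hbCj⟩ := hTj
  obtain ⟨c, hcT, hcCk⟩ := hTk
  have hCiCj : Ci ∩ Cj = {x} := ThmN.inter_eq_singleton_of_mem_trianglesThrough M hC1 hCi hCj hij
  have hCiCk : Ci ∩ Ck = {x} := ThmN.inter_eq_singleton_of_mem_trianglesThrough M hC1 hCi hCk hik
  have hCjCk : Cj ∩ Ck = {x} := ThmN.inter_eq_singleton_of_mem_trianglesThrough M hC1 hCj hCk hjk
  have hab : a ≠ b := by
    intro h
    have : a ∈ Ci ∩ Cj := ⟨haCi, h ▸ hbCj⟩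
    rw [hCiCj] at this
    exact hxT (by rw [← Set.mem_singleton_iff.1 this]; exact haT)
  have hCiE : Ci ⊆ M.E := hCi.1.subset_ground
  have hCjE : Cj ⊆ M.E := hCj.1.subset_ground
  have hTcl : T ⊆ M.closure (Ci ∪ Cj) := by
    refine (triangle_subset_closure_of_two_mem M hT haT hbT hab).trans (M.closure_subset_closure ?_)
    intro z hz
    rcases hz with rfl | hz
    · exact Or.inl haCi
    · rw [Set.mem_singleton_iff.1 hz]; exact Or.inr hbCj
  have hccl : c ∈ M.closure (Ci ∪ Cj) := hTcl hcT
  have hcx : c ≠ x := fun h => hxT (h ▸ hcT)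
  have hcCi : c ∉ Ci := by
    intro h
    have : c ∈ Ci ∩ Ck := ⟨h, hcCk⟩
    rw [hCiCk] at this
    exact hcx (Set.mem_singleton_iff.1 this)
  have hcCj : c ∉ Cj := by
    intro h
    have : c ∈ Cj ∩ Ck := ⟨h, hcCk⟩
    rw [hCjCk] at this
    exact hcx (Set.mem_singleton_iff.1 this)
  -- `C_k ⊆ cl{x, c} ⊆ cl(Cᵢ ∪ Cⱼ)`
  have hCkcl : Ck ⊆ M.closure (Ci ∪ Cj) := by
    refine (triangle_subset_closure_of_two_mem M ⟨hCk.1, hCk.2.1⟩ hCk.2.2 hcCk hcx.symm).trans ?_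
    refine M.closure_subset_closure_of_subset_closure ?_
    intro z hz
    rcases hz with rfl | hz
    · exact M.subset_closure (Ci ∪ Cj) (Set.union_subset hCiE hCjE) (Or.inl hCi.2.2)
    · rw [Set.mem_singleton_iff.1 hz]; exact hccl
  -- the two points of `C_k` off `x`
  have hCkfin : Ck.Finite := M.ground_finite.subset hCk.1.subset_ground
  have h2 : (Ck \ {x}).ncard = 2 := by
    rw [Set.ncard_sdiff' (Set.singleton_subset_iff.2 hCk.2.2) hCkfin, hCk.2.1, Set.ncard_singleton]
  obtain ⟨u, v, huv, huv_eq⟩ := Set.ncard_eq_two.1 h2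
  have hu : u ∈ Ck \ {x} := by rw [huv_eq]; exact Or.inl rfl
  have hv : v ∈ Ck \ {x} := by rw [huv_eq]; exact Or.inr rfl
  have hoff : ∀ z ∈ Ck \ {x}, z ∉ Ci ∪ Cj := by
    intro z hz hz'
    have hzx : z ≠ x := fun h => hz.2 (by rw [h]; exact Set.mem_singleton x)
    rcases hz' with hz' | hz'
    · have : z ∈ Ci ∩ Ck := ⟨hz', hz.1⟩
      rw [hCiCk] at this
      exact hzx (Set.mem_singleton_iff.1 this)
    · have : z ∈ Cj ∩ Ck := ⟨hz', hz.1⟩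
      rw [hCjCk] at this
      exact hzx (Set.mem_singleton_iff.1 this)
  exact false_of_two_mem_closure_union_trianglesThrough M hC1 hC2 hx hCi hCj hij huv
    (hCk.1.subset_ground hu.1) (hCk.1.subset_ground hv.1) (hoff u hu) (hoff v hv) (hCkcl hu.1) (hCkcl hv.1)

/-- **A triangle avoiding `x` has a point off the star** `St = {x} ∪ C₁ ∪ C₂ ∪ C₃` (the star of a point on exactly
three triangles): each `Cᵢ` carries at most one of its points (two common points would make it `Cᵢ ∋ x`), and it
cannot meet all three. -/
theorem exists_mem_notMem_star_of_notMem (M : Matroid α) [M.Finite]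
    (hC1 : ∀ L ⊆ M.E, M.eRk L = 2 → L.ncard ≤ 3)
    (hC2 : ∀ X ⊆ M.E, M.eRk X ≤ 3 → X.ncard ≤ 6) {x : α} (hx : M.IsNonloop x)
    {Ci Cj Ck : Set α} (hCi : Ci ∈ ThmN.trianglesThrough M x) (hCj : Cj ∈ ThmN.trianglesThrough M x)
    (hCk : Ck ∈ ThmN.trianglesThrough M x) (hij : Ci ≠ Cj) (hik : Ci ≠ Ck) (hjk : Cj ≠ Ck)
    {T : Set α} (hT : T ∈ ThmN.triangles M) (hxT : x ∉ T) :
    ∃ q ∈ T, q ∉ ({x} ∪ (Ci ∪ Cj ∪ Ck)) := by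
  by_contra hcon
  push Not at hcon
  have hTsub : T ⊆ Ci ∪ Cj ∪ Ck := by
    intro z hz
    rcases hcon z hz with h | h
    · exact absurd (Set.mem_singleton_iff.1 h ▸ hz) hxT
    · exact h
  have hTfin : T.Finite := M.ground_finite.subset hT.1.subset_ground
  have hle1 : ∀ C ∈ ThmN.trianglesThrough M x, (T ∩ C).ncard ≤ 1 := by
    intro C hC
    rw [Set.ncard_le_one_iff (hTfin.subset Set.inter_subset_left)]
    intro a b ha hb
    have hTC : T ≠ C := fun h => hxT (h ▸ hC.2.2)
    exact eq_of_mem_inter_of_mem_triangles M hC1 hT ⟨hC.1, hC.2.1⟩ hTC ha hb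
  have hTeq : T = (T ∩ Ci) ∪ (T ∩ Cj) ∪ (T ∩ Ck) := by
    ext z
    constructor
    · intro hz
      rcases hTsub hz with (h | h) | h
      · exact Or.inl (Or.inl ⟨hz, h⟩)
      · exact Or.inl (Or.inr ⟨hz, h⟩)
      · exact Or.inr ⟨hz, h⟩
    · intro hz
      rcases hz with (h | h) | h
      · exact h.1
      · exact h.1
      · exact h.1
  have hcount : T.ncard ≤ (T ∩ Ci).ncard + (T ∩ Cj).ncard + (T ∩ Ck).ncard := by
    calc T.ncard = ((T ∩ Ci) ∪ (T ∩ Cj) ∪ (T ∩ Ck)).ncard := by rw [← hTeq]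
      _ ≤ ((T ∩ Ci) ∪ (T ∩ Cj)).ncard + (T ∩ Ck).ncard := Set.ncard_union_le _ _
      _ ≤ (T ∩ Ci).ncard + (T ∩ Cj).ncard + (T ∩ Ck).ncard :=
          Nat.add_le_add_right (Set.ncard_union_le _ _) _
  have hi := hle1 Ci hCi
  have hj := hle1 Cj hCj
  have hk := hle1 Ck hCk
  have hTi : (T ∩ Ci).Nonempty := by
    rw [Set.nonempty_iff_ne_empty]
    intro h
    rw [h, Set.ncard_empty] at hcount
    have := hT.2
    omega
  have hTj : (T ∩ Cj).Nonempty := by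
    rw [Set.nonempty_iff_ne_empty]
    intro h
    rw [h, Set.ncard_empty] at hcount
    have := hT.2
    omega
  have hTk : (T ∩ Ck).Nonempty := by
    rw [Set.nonempty_iff_ne_empty]
    intro h
    rw [h, Set.ncard_empty] at hcount
    have := hT.2
    omega
  exact false_of_inter_nonempty_of_inter_nonempty_of_inter_nonempty M hC1 hC2 hx hCi hCj hCk hij hik hjk hT hxT
    hTi hTj hTk

/-- **The two-star structure**: a triangle `T ∋ q` avoiding `x` whose two other points lie in the star
`{x} ∪ (Cᵢ ∪ Cⱼ ∪ C_k)` has one of them in some `C`, the other in some `C' ≠ C` among the three, and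
`q ∈ cl(C ∪ C')`. -/
theorem exists_pair_closure_of_forall_mem_star (M : Matroid α) [M.Finite]
    (hC1 : ∀ L ⊆ M.E, M.eRk L = 2 → L.ncard ≤ 3) {x : α}
    {Ci Cj Ck : Set α} (hCi : Ci ∈ ThmN.trianglesThrough M x) (hCj : Cj ∈ ThmN.trianglesThrough M x)
    (hCk : Ck ∈ ThmN.trianglesThrough M x)
    {T : Set α} (hT : T ∈ ThmN.triangles M) (hxT : x ∉ T) {q : α} (hqT : q ∈ T)
    (hother : ∀ y ∈ T, y ≠ q → y ∈ ({x} ∪ (Ci ∪ Cj ∪ Ck))) :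
    ∃ C, (C = Ci ∨ C = Cj ∨ C = Ck) ∧ ∃ C', (C' = Ci ∨ C' = Cj ∨ C' = Ck) ∧ C ≠ C' ∧
      (T ∩ C).Nonempty ∧ (T ∩ C').Nonempty ∧ q ∈ M.closure (C ∪ C') := by
  have hTfin : T.Finite := M.ground_finite.subset hT.1.subset_ground
  have h2 : (T \ {q}).ncard = 2 := by
    rw [Set.ncard_sdiff' (Set.singleton_subset_iff.2 hqT) hTfin, hT.2, Set.ncard_singleton]
  obtain ⟨a, b, hab, hab_eq⟩ := Set.ncard_eq_two.1 h2
  have ha : a ∈ T \ {q} := by rw [hab_eq]; exact Or.inl rfl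
  have hb : b ∈ T \ {q} := by rw [hab_eq]; exact Or.inr rfl
  have haq : a ≠ q := fun h => ha.2 (by rw [h]; exact Set.mem_singleton q)
  have hbq : b ≠ q := fun h => hb.2 (by rw [h]; exact Set.mem_singleton q)
  have hmemC : ∀ y ∈ T, y ≠ q → ∃ C, (C = Ci ∨ C = Cj ∨ C = Ck) ∧ y ∈ C := by
    intro y hy hyq
    rcases hother y hy hyq with h | h
    · exact absurd (by rw [← Set.mem_singleton_iff.1 h]; exact hy) hxT
    · rcases h with (h | h) | h
      · exact ⟨Ci, Or.inl rfl, h⟩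
      · exact ⟨Cj, Or.inr (Or.inl rfl), h⟩
      · exact ⟨Ck, Or.inr (Or.inr rfl), h⟩
  obtain ⟨C, hCmem, haC⟩ := hmemC a ha.1 haq
  obtain ⟨C', hC'mem, hbC'⟩ := hmemC b hb.1 hbq
  have hCtri : ∀ D, (D = Ci ∨ D = Cj ∨ D = Ck) → D ∈ ThmN.trianglesThrough M x := by
    intro D hD
    rcases hD with rfl | rfl | rfl
    · exact hCi
    · exact hCj
    · exact hCk
  have hCC' : C ≠ C' := by
    intro h
    subst h
    have hTC : T ≠ C := fun h' => hxT (h' ▸ (hCtri C hCmem).2.2)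
    exact hab (eq_of_mem_inter_of_mem_triangles M hC1 hT ⟨(hCtri C hCmem).1, (hCtri C hCmem).2.1⟩ hTC
      ⟨ha.1, haC⟩ ⟨hb.1, hbC'⟩)
  refine ⟨C, hCmem, C', hC'mem, hCC', ⟨a, ha.1, haC⟩, ⟨b, hb.1, hbC'⟩, ?_⟩
  have hTcl : T ⊆ M.closure (C ∪ C') := by
    refine (triangle_subset_closure_of_two_mem M hT ha.1 hb.1 hab).trans (M.closure_subset_closure ?_)
    intro z hz
    rcases hz with rfl | hz
    · exact Or.inl haC
    · rw [Set.mem_singleton_iff.1 hz]; exact Or.inr hbC'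
  exact hTcl hqT

/-- **Outside points**: a triangle through a point `q ∉ cl(St)` has a second point off `cl(St)` (else `q` lies in the
closure of its two other points, inside `cl(St)`). -/
theorem exists_mem_notMem_closure_of_notMem_closure (M : Matroid α) [M.Finite] {St : Set α}
    {q : α} (hq : q ∉ M.closure St) {T : Set α} (hT : T ∈ ThmN.trianglesThrough M q) :
    ∃ y ∈ T, y ≠ q ∧ y ∉ M.closure St := by
  by_contra hcon
  push Not at hcon
  have hTfin : T.Finite := M.ground_finite.subset hT.1.subset_ground
  have h2 : (T \ {q}).ncard = 2 := by
    rw [Set.ncard_sdiff' (Set.singleton_subset_iff.2 hT.2.2) hTfin, hT.2.1, Set.ncard_singleton]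
  obtain ⟨a, b, hab, hab_eq⟩ := Set.ncard_eq_two.1 h2
  have ha : a ∈ T \ {q} := by rw [hab_eq]; exact Or.inl rfl
  have hb : b ∈ T \ {q} := by rw [hab_eq]; exact Or.inr rfl
  have haq : a ≠ q := fun h => ha.2 (by rw [h]; exact Set.mem_singleton q)
  have hbq : b ≠ q := fun h => hb.2 (by rw [h]; exact Set.mem_singleton q)
  have hacl : a ∈ M.closure St := hcon a ha.1 haq
  have hbcl : b ∈ M.closure St := hcon b hb.1 hbq
  have hTcl : T ⊆ M.closure St := by
    refine (triangle_subset_closure_of_two_mem M ⟨hT.1, hT.2.1⟩ ha.1 hb.1 hab).trans ?_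
    refine M.closure_subset_closure_of_subset_closure ?_
    intro z hz
    rcases hz with rfl | hz
    · exact hacl
    · rw [Set.mem_singleton_iff.1 hz]; exact hbcl
  exact hq (hTcl hT.2.2)

end S1

end PercRepro
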